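/-
COR-CM (cell pub-hodgecm2, stage 2 of the Hodge ladder) — count-neutral KERNEL COMBINATORICS «the binary tetrahedral group SL(2,3)», part II: `𝒦 = G`,
`β = φ₂ + 2` and the floor (seat prover-pub-hodgecm2-b23-g53-0, binder prover b23, gen 53; claim HOME/INBOX.md l.24246, NAME ASK l.24300).  Theorems only,
on part I (`Census/BinaryTetrahedralDatum.lean`), lit-andre-3ʼs type-stabiliser theory (`TypeStabiliser.stabGen`, `indexTwoRank`,
`fibreTwo_add_two_eq_card_block_add_indexTwoRank`) and seat b09ʼs coinvariant floor (`Coinvariant.fibreTwo_le_card`, in gen 45ʼs packaging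
`OcticProduct.fibreTwo_mem_lowerBounds`) BY NAME; no `decide`, no certificate, no named fact, no `sorry`; `Interfaces.lean` (C1), every E term, B01,
`Transposition/*`, `PortJoin/*`, `D2Bridge/*` untouched.  HONEST FRAMING: `HC_CM` is NOT proved, here or anywhere in the tree; nothing here is a period, a
count of record or a headline.
T5: n/a-class (hypothesis binders = the fields of `BinaryTetrahedral.Datum`; checker: self).
-/
import Summits.HodgeConjecture.CorCM.Census.BinaryTetrahedralDatum
import Summits.HodgeConjecture.CorCM.Census.OcticProductStabiliser

/-!
# The binary tetrahedral group, II: `Q ⊴ G`, `𝒦(G, c) = G`, `β = φ₂ + 2`, the floor `μ ≥ β − 2`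

For a binary tetrahedral datum `D : BinaryTetrahedral.Datum G c` (part I): the quaternion subgroup `Q` is normal (§1); the elements `a` and `i a²` of
order `3` lie in `𝒦 = ⟨c, {g | c ∉ ⟨g⟩}⟩`, hence so do `i = (i a²)·a`, `j = a i a⁻¹`, so **`𝒦(G, c) = G`** and `d₂(G/𝒦) = 0`, whence
**`β(G, c) = φ₂(G, c) + 2`** by lit-andre-3ʼs `φ₂ + 2 = β + d₂` (§2); the generic coinvariant floor then reads **`μ(G, c) ≥ β(G, c) − 2 = φ₂(G, c)`**
and the law `μ = φ₂` REDUCES TO THE UPPER BOUND (`isLeast_of_exists_le`, §3) — the OPEN row `SL(2,3)` (`β = 176`, `φ₂ = 174`).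
All [folklore] bookkeeping over [Pohlmann1968, Thm 1] in the reading of [Milne1999, Prop. 2.1].

## References
* [Pohlmann1968] H. Pohlmann, Algebraic cycles on abelian varieties of complex multiplication type, Ann. of Math. 88 (1968), Thm 1.
* [Milne1999] J. S. Milne, Lefschetz motives and the Tate conjecture, Compositio Math. 117 (1999), Prop. 2.1, p. 54.
-/

namespace Summit.HodgeConjecture.CorCM.Census.BinaryTetrahedral

open Finset
open Summit.HodgeConjecture.CorCM.Prior.AllgGroup.RfwfAllgGroup
open Summit.HodgeConjecture.CorCM.Census.BlockParity
open Summit.HodgeConjecture.CorCM.Census.Coinvariant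
open Summit.HodgeConjecture.CorCM.Census.TypeStabiliser
open Summit.HodgeConjecture.CorCM.Census.IndexTwo

noncomputable section

variable {G : Type*} [Group G] [Fintype G] [DecidableEq G] {c : G}
variable (D : Datum G c)

namespace Datum

include D

/-! ## §1 The quaternion subgroup is normal -/

omit [DecidableEq G] in
/-- **The quaternion subgroup is normal**: `y Q y⁻¹ ⊆ Q` (`a i a⁻¹ = j`, `a j a⁻¹ = ij`, and `Q` is a subgroup containing `i, j`). [folklore] -/
theorem conj_mem_Q (y : G) {q : G} (hq : q ∈ D.Q) : y * q * y⁻¹ ∈ D.Q := by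
  -- conjugation by `i`, `j` preserves `Q` trivially; by `a` it maps the words into `Q`
  have ha : ∀ {x : G}, x ∈ D.Q → D.a * x * D.a⁻¹ ∈ D.Q := fun {x} hx => by
    obtain ⟨u, -, v, -, rfl⟩ := D.exists_word_of_mem_Q hx
    rw [← MulAut.conj_apply, map_mul, map_pow, map_pow, MulAut.conj_apply, MulAut.conj_apply, D.hai, D.haj]
    exact mul_mem (D.Q.pow_mem D.hjQ u) (D.Q.pow_mem (mul_mem D.hiQ D.hjQ) v)
  have hapow : ∀ (e : ℕ) {x : G}, x ∈ D.Q → D.a ^ e * x * (D.a ^ e)⁻¹ ∈ D.Q := by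
    intro e
    induction e with
    | zero => intro x hx; simpa using hx
    | succ n ih =>
      intro x hx
      have : D.a ^ (n + 1) * x * (D.a ^ (n + 1))⁻¹ = D.a ^ n * (D.a * x * D.a⁻¹) * (D.a ^ n)⁻¹ := by
        rw [pow_succ']; group
      rw [this]
      exact ih (ha hx)
  obtain ⟨u, -, v, -, e, -, rfl⟩ := D.exhaust y
  have hw : D.i ^ u * D.j ^ v ∈ D.Q := D.word_mem_Q u v
  have : D.i ^ u * D.j ^ v * D.a ^ e * q * (D.i ^ u * D.j ^ v * D.a ^ e)⁻¹ =
      (D.i ^ u * D.j ^ v) * (D.a ^ e * q * (D.a ^ e)⁻¹) * (D.i ^ u * D.j ^ v)⁻¹ := by group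
  rw [this]
  exact mul_mem (mul_mem hw (hapow e hq)) (inv_mem hw)

/-! ## §2 `𝒦(G, c) = G` and `β = φ₂ + 2` -/

omit [Fintype G] [DecidableEq G] in
/-- `a ∈ 𝒦` (odd order). [folklore] -/
theorem a_mem_stabGen : D.a ∈ stabGen c :=
  mem_stabGen_of_odd_orderOf c D.c_mul_c D.c_ne_one (by rw [D.hord_a]; decide)

omit [Fintype G] [DecidableEq G] in
/-- `i a² ∈ 𝒦` (odd order). [folklore] -/
theorem i_mul_a_sq_mem_stabGen : D.i * D.a ^ 2 ∈ stabGen c :=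
  mem_stabGen_of_odd_orderOf c D.c_mul_c D.c_ne_one (by rw [D.orderOf_i_mul_a_sq]; decide)

omit [Fintype G] [DecidableEq G] in
/-- `i = (i a²)·a ∈ 𝒦`. [folklore] -/
theorem i_mem_stabGen : D.i ∈ stabGen c := by
  have h : D.i = D.i * D.a ^ 2 * D.a := by rw [mul_assoc, ← pow_succ, D.a_pow_three, mul_one]
  rw [h]
  exact (stabGen c).mul_mem D.i_mul_a_sq_mem_stabGen D.a_mem_stabGen

omit [Fintype G] [DecidableEq G] in
/-- `j = a i a⁻¹ ∈ 𝒦`. [folklore] -/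
theorem j_mem_stabGen : D.j ∈ stabGen c := by
  rw [← D.hai]
  exact (stabGen c).mul_mem ((stabGen c).mul_mem D.a_mem_stabGen D.i_mem_stabGen) ((stabGen c).inv_mem D.a_mem_stabGen)

omit [DecidableEq G] in
/-- **Every element lies in `𝒦(G, c)`** (`⊤ ≤ 𝒦`). [folklore] -/
theorem top_le_stabGen : (⊤ : Subgroup G) ≤ stabGen c := fun y _ => by
  obtain ⟨u, -, v, -, e, -, rfl⟩ := D.exhaust y
  exact (stabGen c).mul_mem ((stabGen c).mul_mem ((stabGen c).pow_mem D.i_mem_stabGen u) ((stabGen c).pow_mem D.j_mem_stabGen v))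
    ((stabGen c).pow_mem D.a_mem_stabGen e)

omit [DecidableEq G] in
/-- `𝒦(G, c) = ⊤`. [folklore] -/
private theorem stabGen_eq_top : stabGen c = ⊤ := top_unique D.top_le_stabGen

omit [DecidableEq G] in
/-- `d₂(G/𝒦) = 0`. [folklore] -/
private theorem indexTwoRank_stabGen_eq_zero : indexTwoRank (stabGen c) = 0 := by
  rw [D.stabGen_eq_top]; exact indexTwoRank_top

/-- **`β(G, c) = φ₂(G, c) + 2`** for every binary tetrahedral datum (`φ₂` at the datumʼs own `c² = 1`). [folklore] -/
theorem card_block_eq_fibreTwo_add_two : Fintype.card (Block c) = fibreTwo c D.c_mul_c + 2 := by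
  have h := fibreTwo_add_two_eq_card_block_add_indexTwoRank c D.c_mul_c D.c_ne_one D.hcen ⟨6, by rw [D.card_eq]⟩
  rw [D.indexTwoRank_stabGen_eq_zero, add_zero] at h
  exact h.symm

/-! ## §3 The floor `μ ≥ β − 2` -/

/-- **THE FLOOR `μ(G, c) ≥ β(G, c) − 2`**: every family `S` of faces whose base changes generate the Hodge span modulo pairs has `β ≤ |S| + 2`.
[folklore] -/
theorem card_block_le_card_add_two (S : Finset (CMF G c →₀ ℤ)) (hSF : (S : Set (CMF G c →₀ ℤ)) ⊆ gfaceSet G c D.c_mul_c)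
    (hgen : hodgeSpan c D.c_mul_c ≤ Submodule.span ℤ (pairSet c) ⊔ Submodule.span ℤ (translates c S)) :
    Fintype.card (Block c) ≤ S.card + 2 := by
  have hfloor := OcticProduct.fibreTwo_mem_lowerBounds D.c_mul_c D.hcen ⟨S, hSF, rfl, hgen⟩
  rw [D.card_block_eq_fibreTwo_add_two]
  exact Nat.add_le_add_right hfloor 2

/-- The floor in `fibreTwo` currency: `φ₂(G, c)` bounds below the size of every generating face family, and `φ₂ + 2 = β`. [folklore] -/
theorem fibreTwo_mem_lowerBounds :
    fibreTwo c D.c_mul_c ∈ lowerBounds {m : ℕ | ∃ S : Finset (CMF G c →₀ ℤ), ↑S ⊆ gfaceSet G c D.c_mul_c ∧ S.card = m ∧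
      hodgeSpan c D.c_mul_c ≤ Submodule.span ℤ (pairSet c) ⊔ Submodule.span ℤ (translates c S)} ∧
    fibreTwo c D.c_mul_c + 2 = Fintype.card (Block c) :=
  ⟨OcticProduct.fibreTwo_mem_lowerBounds D.c_mul_c D.hcen, D.card_block_eq_fibreTwo_add_two.symm⟩

/-- **The law reduces to the upper bound**: if SOME family of at most `φ₂(G, c)` faces generates, then `μ(G, c) = φ₂(G, c) = β(G, c) − 2` (the
`SL(2,3)` row: `174` faces wanted). [folklore] -/
theorem isLeast_of_exists_le
    (hex : ∃ S : Finset (CMF G c →₀ ℤ), ↑S ⊆ gfaceSet G c D.c_mul_c ∧ S.card ≤ fibreTwo c D.c_mul_c ∧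
      hodgeSpan c D.c_mul_c ≤ Submodule.span ℤ (pairSet c) ⊔ Submodule.span ℤ (translates c S)) :
    IsLeast {m : ℕ | ∃ S : Finset (CMF G c →₀ ℤ), ↑S ⊆ gfaceSet G c D.c_mul_c ∧ S.card = m ∧
      hodgeSpan c D.c_mul_c ≤ Submodule.span ℤ (pairSet c) ⊔ Submodule.span ℤ (translates c S)} (fibreTwo c D.c_mul_c) := by
  obtain ⟨S, hSF, hcard, hgen⟩ := hex
  have hge : fibreTwo c D.c_mul_c ≤ S.card := D.fibreTwo_mem_lowerBounds.1 ⟨S, hSF, rfl, hgen⟩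
  exact ⟨⟨S, hSF, le_antisymm hcard hge, hgen⟩, D.fibreTwo_mem_lowerBounds.1⟩

end Datum

end

end Summit.HodgeConjecture.CorCM.Census.BinaryTetrahedral
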